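import Summits.HodgeConjecture.CorCM.IrreducibleOddWeightsSchurTest
import Summits.HodgeConjecture.CorCM.IrreducibleOddWeightsWielandtCMFields
import HarnessLib

/-!
# The Schur test for a CM field: irreducible odd weights ⟺ every odd-valued `Aut(ℂ)`-equivariant endomorphism of
# `ℚ^{Hom(K,ℂ)}` is zero or injective on the odd weights

COR-CM (cell `pub-hodgecm2`, binder seat `b16` gen 55, count-neutral claim IRR-ODD, file F8b — the CM-field dress of F8
`CorCM/IrreducibleOddWeightsSchurTest`; theorems only, no definition, no named fact, no `sorry`).  NEW as stated, hence
under `Summits/`.  HONEST FRAMING: statements about the `Aut(ℂ)`-module of odd weights of ONE CM field `K`; `HC_CM` is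
neither used nor asserted.

* **`antiWeights_irreducible_iff_forall_ker`** — (IRR) for `K` ⟺ every `Aut(ℂ)`-equivariant endomorphism of
  `ℚ^{Hom(K,ℂ)}` with conjugation-odd values that kills one non-zero odd weight kills all of them (the commutant of
  `Anti` has no zero divisors; no orbit data needed).
* **`antiWeights_irreducible_iff_forall_coeffs`** — with `p` non-associate witnesses `y_j` against (SC) at `x₀`
  covering, with the (SC)-pairs, all of `Hom(K,ℂ) ∖ {x₀, x̄₀}`, and their orbital operators `T_j`: (IRR) ⟺ no combination
  `c₀·(f − f∘ρ) + Σ_j c_j·T_j` kills a non-zero odd weight unless it kills all (Wielandt coordinates; the general-`p`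
  form of F7b's eigenvector test).
* `isNondegenerate_of_forall_ker`, `isSimple_of_forall_ker` — then every CM type of `K` is nondegenerate and every
  abelian variety with CM by `K` is simple (F2).

## References

* [Serre1977] J.-P. Serre, *Linear Representations of Finite Groups*, GTM 42 (1977), §1.3 Thm. 1, §2.2 Prop. 4.
* [Wielandt1964] H. Wielandt, *Finite Permutation Groups* (1964), Thm. 28.4, §29.
* [Shimura1998] G. Shimura, *Abelian Varieties with Complex Multiplication and Modular Functions*, §8.2 Prop. 26.
-/

set_option autoImplicit false

noncomputable section

open CategoryTheory CategoryTheory.Limits NumberField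

namespace Summit.HodgeConjecture.CorCM

open Literature.NumberTheory.ComplexMultiplication
open Literature.AlgebraicGeometry.Motives (AbelianVariety CMType)
open Literature.AlgebraicGeometry.HodgeTheory
open Literature.AlgebraicGeometry.ComplexMultiplication (IsCMTypeRealisation)
open Literature.AlgebraicGeometry.Pohlmann1968
open GenericCMField
open scoped Classical

variable {K : Type} [Field K] [NumberField K] [IsCMField K]

/-- **THE SCHUR TEST for a CM field**: the odd weights of `K` are an irreducible `Aut(ℂ)`-module iff every
`Aut(ℂ)`-equivariant odd-valued endomorphism of `ℚ^{Hom(K,ℂ)}` killing one non-zero odd weight kills every odd weight.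
[cite: Serre1977, §1.3 Thm. 1 and §2.2 Prop. 4] -/
theorem antiWeights_irreducible_iff_forall_ker :
    (∀ W : Submodule ℚ ((K →+* ℂ) → ℚ), W ≤ antiWeights (E := K →+* ℂ) (starRingAut : ℂ ≃+* ℂ) → W ≠ ⊥ →
      (∀ (k : ℂ ≃+* ℂ) (f : (K →+* ℂ) → ℚ), f ∈ W → (fun y => f (k • y)) ∈ W) →
      W = antiWeights (E := K →+* ℂ) (starRingAut : ℂ ≃+* ℂ)) ↔
    ∀ S : ((K →+* ℂ) → ℚ) →ₗ[ℚ] ((K →+* ℂ) → ℚ),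
      (∀ (g : ℂ ≃+* ℂ) (f : (K →+* ℂ) → ℚ), S (fun x => f (g⁻¹ • x)) = fun x => S f (g⁻¹ • x)) →
      (∀ (f : (K →+* ℂ) → ℚ) (x : K →+* ℂ), S f ((starRingAut : ℂ ≃+* ℂ) • x) = -S f x) →
      ∀ a ∈ antiWeights (E := K →+* ℂ) (starRingAut : ℂ ≃+* ℂ), a ≠ 0 → S a = 0 →
        ∀ b ∈ antiWeights (E := K →+* ℂ) (starRingAut : ℂ ≃+* ℂ), S b = 0 :=
  IrrOdd.irreducible_iff_forall_ker (G := ℂ ≃+* ℂ) smul_conj_smul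

/-- **THE SCHUR TEST IN WIELANDT COORDINATES for a CM field**: `y_1, …, y_p ∉ {x₀, x̄₀}` non-associate witnesses against
(SC) at `x₀`, every other embedding off `{x₀, x̄₀}` passing (SC) at `x₀` or conjugate over `x₀(K)` to some `y_j` or
`ȳ_j`, `T_j` their orbital operators: (IRR) ⟺ no combination `c₀·(f − f∘ρ) + Σ_j c_j·T_j` kills a non-zero odd weight
unless it kills all. [cite: Wielandt1964, Thm. 28.4] [cite: Serre1977, §2.2 Prop. 4] -/
theorem antiWeights_irreducible_iff_forall_coeffs {p : ℕ} {x₀ : K →+* ℂ} (y : Fin p → (K →+* ℂ))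
    (hy₀ : ∀ j, y j ≠ x₀) (hy₀' : ∀ j, y j ≠ (starRingAut : ℂ ≃+* ℂ) • x₀)
    (hncs : ∀ j (σ : ℂ ≃+* ℂ), σ • x₀ = x₀ → σ • y j ≠ (starRingAut : ℂ ≃+* ℂ) • y j)
    (hsep : ∀ j k, j ≠ k → ∀ σ : ℂ ≃+* ℂ, σ • x₀ = x₀ →
      σ • y j ≠ y k ∧ σ • y j ≠ (starRingAut : ℂ ≃+* ℂ) • y k)
    (hcover : ∀ x : K →+* ℂ, x ≠ x₀ → x ≠ (starRingAut : ℂ ≃+* ℂ) • x₀ →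
      (∃ σ : ℂ ≃+* ℂ, σ • x₀ = x₀ ∧ σ • x = (starRingAut : ℂ ≃+* ℂ) • x) ∨
        ∃ (j : Fin p) (σ : ℂ ≃+* ℂ), σ • x₀ = x₀ ∧ (σ • y j = x ∨ σ • y j = (starRingAut : ℂ ≃+* ℂ) • x))
    (T : Fin p → (((K →+* ℂ) → ℚ) →ₗ[ℚ] ((K →+* ℂ) → ℚ)))
    (hT : ∀ j (g : ℂ ≃+* ℂ) (f : (K →+* ℂ) → ℚ), T j (fun x => f (g⁻¹ • x)) = fun x => T j f (g⁻¹ • x))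
    (hTodd : ∀ j (f : (K →+* ℂ) → ℚ) (x : K →+* ℂ), T j f ((starRingAut : ℂ ≃+* ℂ) • x) = -T j f x)
    (hTδ : ∀ j (z : K →+* ℂ), T j (fun y' => if y' = x₀ then (1 : ℚ) else 0) z =
      (if ∃ g : ℂ ≃+* ℂ, g • x₀ = x₀ ∧ g • y j = z then (1 : ℚ) else 0) -
        if ∃ g : ℂ ≃+* ℂ, g • x₀ = x₀ ∧ g • y j = (starRingAut : ℂ ≃+* ℂ) • z then (1 : ℚ) else 0) :
    (∀ W : Submodule ℚ ((K →+* ℂ) → ℚ), W ≤ antiWeights (E := K →+* ℂ) (starRingAut : ℂ ≃+* ℂ) → W ≠ ⊥ →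
      (∀ (k : ℂ ≃+* ℂ) (f : (K →+* ℂ) → ℚ), f ∈ W → (fun y => f (k • y)) ∈ W) →
      W = antiWeights (E := K →+* ℂ) (starRingAut : ℂ ≃+* ℂ)) ↔
    ∀ (c₀ : ℚ) (c : Fin p → ℚ), ∀ a ∈ antiWeights (E := K →+* ℂ) (starRingAut : ℂ ≃+* ℂ), a ≠ 0 →
      c₀ • (fun x => a x - a ((starRingAut : ℂ ≃+* ℂ) • x)) + ∑ j, c j • T j a = 0 →
      ∀ b ∈ antiWeights (E := K →+* ℂ) (starRingAut : ℂ ≃+* ℂ),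
        c₀ • (fun x => b x - b ((starRingAut : ℂ ≃+* ℂ) • x)) + ∑ j, c j • T j b = 0 := by
  haveI := isPretransitive_ringEquiv_complex (K := K)
  exact IrrOdd.irreducible_iff_forall_coeffs (G := ℂ ≃+* ℂ) smul_conj_smul conj_smul_conj_smul conj_smul_ne y hy₀
    hy₀' hncs hsep hcover T hT hTodd hTδ

/-- **Schur test passed ⟹ every CM type of `K` is nondegenerate** (via (IRR), F2). [cite: Shimura1998, §8.2 Prop. 26] -/
theorem isNondegenerate_of_forall_ker
    (hker : ∀ S : ((K →+* ℂ) → ℚ) →ₗ[ℚ] ((K →+* ℂ) → ℚ),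
      (∀ (g : ℂ ≃+* ℂ) (f : (K →+* ℂ) → ℚ), S (fun x => f (g⁻¹ • x)) = fun x => S f (g⁻¹ • x)) →
      (∀ (f : (K →+* ℂ) → ℚ) (x : K →+* ℂ), S f ((starRingAut : ℂ ≃+* ℂ) • x) = -S f x) →
      ∀ a ∈ antiWeights (E := K →+* ℂ) (starRingAut : ℂ ≃+* ℂ), a ≠ 0 → S a = 0 →
        ∀ b ∈ antiWeights (E := K →+* ℂ) (starRingAut : ℂ ≃+* ℂ), S b = 0)
    (Φ : CMType K) : IsNondegenerate Φ :=
  isNondegenerate_of_irreducible (antiWeights_irreducible_iff_forall_ker.2 hker) Φ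

/-- **Schur test passed ⟹ every abelian variety with CM by `K` is simple.** [cite: Shimura1998, §8.2 Prop. 26] -/
theorem isSimple_of_forall_ker
    (hker : ∀ S : ((K →+* ℂ) → ℚ) →ₗ[ℚ] ((K →+* ℂ) → ℚ),
      (∀ (g : ℂ ≃+* ℂ) (f : (K →+* ℂ) → ℚ), S (fun x => f (g⁻¹ • x)) = fun x => S f (g⁻¹ • x)) →
      (∀ (f : (K →+* ℂ) → ℚ) (x : K →+* ℂ), S f ((starRingAut : ℂ ≃+* ℂ) • x) = -S f x) →
      ∀ a ∈ antiWeights (E := K →+* ℂ) (starRingAut : ℂ ≃+* ℂ), a ≠ 0 → S a = 0 →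
        ∀ b ∈ antiWeights (E := K →+* ℂ) (starRingAut : ℂ ≃+* ℂ), S b = 0)
    {Φ : CMType K} {A : AbelianVariety ℂ} {ι : 𝓞 K →+* End A} {θ : K →+* Module.End ℂ (complexBetti A.X 1)}
    (hA : IsCMTypeRealisation Φ A ι θ) : A.IsSimple :=
  isSimple_of_irreducible (antiWeights_irreducible_iff_forall_ker.2 hker) hA

end Summit.HodgeConjecture.CorCM

end
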